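import Summits.QuantumFields.YangMills.Theorems.BalabanUVNodesPortS1JacRepresents
import Summits.QuantumFields.YangMills.Theorems.BalabanUVNodesPortS1JacRowsDefs
import Summits.QuantumFields.YangMills.Theorems.BalabanUVNodesPortS1HalvesJacGlue
import Summits.QuantumFields.YangMills.Theses.BalabanUVNodes
import Summits.QuantumFields.YangMills.Theorems.BalabanUVNodesPortS1JacKStepGlue

/-!
# NODE O port PT-A — ★★★ THE δ-JACOBIAN SUB-HALF OF 27930 MODULO ITS ANALYTIC ROWS: `JacRowsAB F → PortRecordLZjacHalf F`, and the crux `PortRecordRepresentationS1` from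
# `(∀ F, JacRowsAB F)`, the Gaussian sub-half and the fluctuation half — the glue of the RESHAPED skeleton `pta_residueW` (stub `stub_LZjac` ↦ `stub_LZjacAB`)

Cell `ym-nodeO-ideate`, porter seat `ymgap-nodeO-port-PTA-1` (gen 6); `--supports stmt-QuantumFields-27930` (helper).  Ingredients, all ✓ this lineage: the integer formula `Ψ_jac` with (LOC) `isLocal_ΨjacRaw`
(p814447) and (GI) `isGaugeInv_ΨjacRaw` (p814868); the torus pieces `E_T = jacTorusPieces` with rows (c)(d) `localOnW_∕gaugeInvOnW_jacTorusPieces` and rows (a)(b) on∕off the wrap class from the per-bond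
rows (p815553, p815904); the representation (f′)-W `representsW_phiLZjac` (p816006); gen 5's `sig27930v8LR4_of_three` (✓p812279).  [I] = [Balaban1987RG1].
WHAT IS DISPLAYED.  `JacRowsAB F` (✓ `…JacRowsDefs`): per coarse bond `c`, analyticity of `ψ ↦ J_T(c, ψ.1)` and `‖J_T(c, 𝐔) − J_T(c, 1)‖ ≤ E` at the pairs of `recordUc … X(c)` — print's «h(c) analytic on
(1.11)–(1.16)» ([I] p.267–268) with [15] Prop. 9's uniform smallness; porter PTZ-1's `…JacobianHoloDomain*` files are its one-step content.  Nothing else of `stub_LZjac` remains.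
* ★★★ `lzjacHalf_of_jacRowsAB`, `lzjacHalf_of_jacRowsAB_all`, ★★★ `sig27930v8LR4_of_jacRowsAB`.

HONEST FRAMING.  Glue; the analytic rows are a DISPLAYED HYPOTHESIS, not proved; `stub_LZdet` BLOCKED-ON P0 (α)+(β) and `stub_FE` XXL are untouched; NOTHING of Bałaban's estimates asserted, ported
or discharged; 27930 OPEN · no claim; K0⁷∕K-Ax OPEN; NODE O 0∕1; COUNT 8∕28 · K 1∕4 UNMOVED; finite `𝕋⁴_{L^K}` at fixed ε — NOT continuum ∕ OS ∕ Clay; **the Yang–Mills mass gap is NOT proved by any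
of this.**  No `sorry`, no `def`, no `instance`, no `notation`; standard axioms.
-/

noncomputable section

open scoped BigOperators Matrix.Norms.L2Operator Topology

namespace Summit.QuantumFields.YangMills.Theorems.BalabanUVNodesPortS1

open Summit.QuantumFields.YangMills.Theorems.K0RecordFormatNames
open Literature.MathematicalPhysics.QuantumFieldTheory.Balaban1983to89
open Literature.MathematicalPhysics.QuantumFieldTheory.Balaban1983to89.Node00
open Literature.MathematicalPhysics.QuantumFieldTheory.Balaban1983to89.T4Continuum (T4Family)

/-! ## ★★★ THE δ-JACOBIAN SUB-HALF FROM ITS ANALYTIC ROWS: `JacRowsAB F → PortRecordLZjacHalf F` -/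

/-- ★★★ **`lzjacHalf_of_jacRowsAB`** — THE δ-JACOBIAN SUB-HALF OF 27930's LZ HALF, MODULO ITS ANALYTIC ROWS (a)(b): given `JacRowsAB F` (analyticity + uniform bound of the torus Jacobian functional
on the record spaces), the registered stub statement `PortRecordLZjacHalf F` holds — with `Ψ := Ψ_jac` (the integer formula of the universal cover, (LOC)(GI) ✓), `Ew := E_T` (the torus pieces),
`E₁ := 8 Mc⁴ E e^κ`, `κ := max (4κ₀(64,8)) 0`, the radii of `JacRowsAB`, and the representation (f′)-W from ⁸'s TokE + TokP9-reg shapes (✓ `representsW_phiLZjac`).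
[cite: Balaban1987RG1, (1.6)–(1.7) p.261, (1.18)–(1.19) p.263, (1.21) p.264, p.268] -/
theorem lzjacHalf_of_jacRowsAB (F : T4Family) (h : JacRowsAB F) : PortRecordLZjacHalf F := by
  obtain ⟨Mth, hrows⟩ := h
  refine ⟨Mth, ?_⟩
  intro Mc hMth j c c₀ c₁ B₃ B₃' a₀ a₁ hMcG _ _ _ hB₃ _ ha₀ ha₁ _ _ hTokE hP9 _ ε₂₉ hε₂₉
  obtain ⟨α₀, α₁, E, hα₀, hα₁, hE, hAB⟩ := hrows Mc hMth hMcG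
  have hMc0 : 0 < Mc := by obtain ⟨c', rfl⟩ := hMcG; exact pow_pos (by have := F.hL.2; omega) _
  have hLpos : (0 : ℝ) < F.L := by
    have hL1 : 0 < F.L := by have := F.hL.2; omega
    exact_mod_cast hL1
  have hL2 : (0 : ℝ) < 2 * (F.L : ℝ) ^ 2 := by positivity
  have hB₃pos : 0 < B₃ := lt_of_lt_of_le hL2 hB₃
  -- the TokE shape at one admissible `ε₁`
  set ε₁ : ℝ := min a₁ (a₀ / B₃) with hε₁def
  have hε₁ : 0 < ε₁ := lt_min ha₁ (div_pos ha₀ hB₃pos)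
  have hε₁a₁ : ε₁ ≤ a₁ := min_le_left _ _
  have hε₁a₀ : B₃ * ε₁ ≤ a₀ := by
    calc B₃ * ε₁ ≤ B₃ * (a₀ / B₃) := by gcongr; exact min_le_right _ _
      _ = a₀ := by field_simp
  have hTokE' : ∀ (k n : ℕ) (V : GaugeField (F.P (recordK₀ F Mc k + n)) (k + 1) (SU 2)), PlaqSmall ε₁ V →
      UkExists F 2 (recordK₀ F Mc k + n) (k + 1) a₀ V ∧ UniqueUkOrbit F 2 (recordK₀ F Mc k + n) (k + 1) a₀ V :=
    fun k n V hV => hTokE ε₁ hε₁ hε₁a₁ hε₁a₀ k n V hV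
  -- the constants
  set κ : ℝ := max (4 * B12TreeDecay.kappa₀ (4 * 2 ^ 4) (2 * 4)) 0 with hκdef
  have hκ : 0 ≤ κ := le_max_right _ _
  refine ⟨8 * (Mc : ℝ) ^ 4 * E * Real.exp κ, κ, α₀, α₁, by positivity, le_max_left _ _, hα₀, hα₁, fun k => ?_⟩
  refine ⟨⟨ΨjacRaw F Mc k, isLocal_ΨjacRaw F hMc0 k, isGaugeInv_ΨjacRaw F Mc k⟩, jacTorusPieces F Mc k, ?_⟩
  exact ⟨analyticOnUcOff_ΨjacRaw F hMcG k (fun n c φ hφ => (hAB k n c φ hφ).1),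
    bound118OnUcOff_ΨjacRaw F hMcG k hE hκ (fun n c φ hφ => (hAB k n c φ hφ).2),
    analyticOnW_jacTorusPieces F (fun n c φ hφ => (hAB k n c φ hφ).1),
    bound118OnW_jacTorusPieces F hMcG hE hκ (fun n c φ hφ => (hAB k n c φ hφ).2),
    localOnW_jacTorusPieces F hMcG k, gaugeInvOnW_jacTorusPieces F Mc k,
    representsW_phiLZjac F hMcG a₀ ε₂₉ k hε₁ (hTokE' k) (fun n => hP9 k n ε₂₉ hε₂₉)⟩

/-- **The global form**: rows (a)(b) for every torus family give the δ-Jacobian sub-half for every torus family (the shape the skeleton `pta_residueW` composes). [cite: Balaban1987RG1, (1.18) p.263, p.268] -/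
theorem lzjacHalf_of_jacRowsAB_all (h : ∀ F : T4Family, JacRowsAB F) : ∀ F : T4Family, PortRecordLZjacHalf F :=
  fun F => lzjacHalf_of_jacRowsAB F (h F)

/-- ★★★ **THE CRUX FROM THE RESHAPED STUBS**: rows (a)(b) of the δ-Jacobian sub-half, the Gaussian sub-half and the fluctuation half give 27930 ⁸-Ax-LR4 for every torus family (`sig27930v8LR4_of_three`).
[cite: Balaban1987RG1, Theorem 3 p.263, (1.6)–(1.21) pp.261–264] -/
theorem sig27930v8LR4_of_jacRowsAB (hAB : ∀ F : T4Family, JacRowsAB F) (hLZdet : ∀ F : T4Family, PortRecordLZdetHalf F) (hFE : ∀ F : T4Family, PortRecordFEHalf F) :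
    Summit.QuantumFields.YangMills.Theses.BalabanUVNodes.PortRecordRepresentationS1 :=
  sig27930v8LR4_of_three (lzjacHalf_of_jacRowsAB_all hAB) hLZdet hFE

/-! ## (gen 6 addendum) ★★★ THE CRUX FROM THE FOUR RESHAPED STUBS `(JacRowsABDom, JacKStep, PortRecordLZdetHalf, PortRecordFEHalf)` -/

/-- ★★★ **THE CRUX FROM THE FOUR RESHAPED STUBS** (skeleton `pta_residueW` v3): the complex-domain rows `JacRowsABDom`, the `k`-step reading `JacKStep` (glued to `JacRowsAB` by
`…JacKStepGlue.jacRowsAB_all_of_kstep_of_dom`), the Gaussian sub-half and the fluctuation half give 27930 ⁸-Ax-LR4 for every torus family (`sig27930v8LR4_of_jacRowsAB`).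
[cite: Balaban1987RG1, Theorem 3 p.263, (1.6)–(1.21) pp.261–264, p.263 L8–10] -/
theorem sig27930v8LR4_of_dom_kstep (hDom : ∀ F : T4Family, JacRowsABDom F) (hK : ∀ F : T4Family, JacKStep F)
    (hLZdet : ∀ F : T4Family, PortRecordLZdetHalf F) (hFE : ∀ F : T4Family, PortRecordFEHalf F) :
    Summit.QuantumFields.YangMills.Theses.BalabanUVNodes.PortRecordRepresentationS1 :=
  sig27930v8LR4_of_jacRowsAB (jacRowsAB_all_of_kstep_of_dom hK hDom) hLZdet hFE

end Summit.QuantumFields.YangMills.Theorems.BalabanUVNodesPortS1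

end
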